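import Mathlib
import Summits.ResolutionOfSingularities.ResolutionOfSingularities.Theorems.WildQuotientsWildQuotientResolutionCyclicTransferAlgebra
import Summits.ResolutionOfSingularities.ResolutionOfSingularities.Theorems.WildQuotientsWildQuotientResolutionCyclicTransferFixedPoint
import Summits.ResolutionOfSingularities.ResolutionOfSingularities.Theorems.WildQuotientsWildQuotientResolutionCyclicTransferAugIdealLocalization
import Literature.AlgebraicGeometry.RelativeSpec.FiniteGroupQuotientGluedProperties
import Literature.AlgebraicGeometry.Resolution.ProjectiveSpaceRegular

/-!
# Cyclic divisorial transfer — the chart form: rings of invariants of a chart are regular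
(crux stmt-ResolutionOfSingularities-15640 `WildQuotients.WildQuotientResolution`, line `Sketch`)

For an action `ρ` of a group `G` of prime order `p` on a regular integral scheme `X` over
`r : X → Y` and an open `U ⊆ Y` with `r⁻¹U` affine, if at every point `x` fixed by `g ∈ G` the
augmentation ideal `(g♯ s - s : s ∈ 𝒪_{X,x})` of the stalk action is principal (the
Király–Lütkebohmert terminal state), then the ring of invariants `Γ(X, r⁻¹U)^G` is a regular
ring (given that it is Noetherian, e.g. `r` affine of finite type over a locally Noetherian base).
This is `CyclicTransfer.isRegularRing_eqLocus` for `B = Γ(X, r⁻¹U)` and `σ = act g₀`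
(`g₀` a generator), the localised divisorial hypothesis at a `σ`-fixed prime being supplied by
`stub_fixedPoint_of_comap_act` (the prime is the prime of a fixed point) and
`stub_augIdeal_localization_of_stalk` (stalk form ⟹ localised form).
-/

set_option linter.dupNamespace false

noncomputable section

open CategoryTheory Limits AlgebraicGeometry TopologicalSpace IsLocalRing
open Literature.AlgebraicGeometry.Resolution Literature.AlgebraicGeometry.RelativeSpec

namespace Summit.ResolutionOfSingularities.ResolutionOfSingularities.Theorems.WildQuotientResolution.CyclicTransfer

/-- **Chart form of the cyclic divisorial transfer.** `ρ` an action of a group `G` of prime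
order `p` on the regular integral locally Noetherian scheme `X` over `r : X → Y`, `U ⊆ Y` an
open with `r⁻¹U` affine, the ring of invariants `Γ(X, r⁻¹U)^G` Noetherian; if for every `g` and
every `g`-fixed point `x` the augmentation ideal `(g♯ s - s : s ∈ 𝒪_{X,x})` of the stalk action
is principal, then `Γ(X, r⁻¹U)^G` is a regular ring. (With `g₀` a generator and `σ = act g₀`,
`Γ(X, r⁻¹U)^G = B^σ`; a `σ`-fixed prime of `B = Γ(X, r⁻¹U)` is the prime of a point fixed by
`g₀⁻¹` (`stub_fixedPoint_of_comap_act`), where the stalk hypothesis localises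
(`stub_augIdeal_localization_of_stalk`); conclude by `isRegularRing_eqLocus`.)
[cite: KiralyLutkebohmert2013, Thm 2] -/
theorem isRegularRing_invariantsRing {X Y : Scheme.{0}} {r : X ⟶ Y} {G : Type} [Group G]
    [Finite G] (ρ : ActionOver r G) {p : ℕ} (hp : p.Prime) (hcard : Nat.card G = p)
    [IsIntegral X] [IsLocallyNoetherian X] (hreg : Scheme.IsRegular X)
    (U : Y.Opens) (hU : IsAffineOpen (r ⁻¹ᵁ U)) [IsNoetherianRing (ρ.invariantsRing U)]
    (hdiv : ∀ (g : G) (x : X) (hgx : (ρ.aut g).hom.base x = x),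
      (Ideal.span (Set.range fun s : X.presheaf.stalk x =>
        (X.presheaf.stalkSpecializes (specializes_of_eq hgx) ≫ (ρ.aut g).hom.stalkMap x).hom s -
          s)).IsPrincipal) :
    IsRegularRing (ρ.invariantsRing U) := by
  classical
  letI := ρ.mulSemiringAction U
  haveI := ρ.isInvariant_invariantsRing U
  haveI : Algebra.IsIntegral (ρ.invariantsRing U) Γ(X, r ⁻¹ᵁ U) :=
    Algebra.IsInvariant.isIntegral (ρ.invariantsRing U) Γ(X, r ⁻¹ᵁ U) G
  refine isRegularRing_iff.mpr fun 𝔭 _ => ?_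
  -- a prime `𝔮` of `B = Γ(X, r⁻¹U)` over `𝔭`; so `r⁻¹U` is non-empty and `B` is a regular domain
  obtain ⟨𝔮, -, h𝔮, -⟩ := Ideal.exists_ideal_over_prime_of_isIntegral 𝔭 (⊥ : Ideal Γ(X, r ⁻¹ᵁ U))
    (by
      rw [← RingHom.ker_eq_comap_bot, (RingHom.injective_iff_ker_eq_bot _).mp]
      · exact bot_le
      · exact Subtype.val_injective)
  have hmem : hU.fromSpec.base ⟨𝔮, h𝔮⟩ ∈ r ⁻¹ᵁ U := hU.range_fromSpec.le ⟨⟨𝔮, h𝔮⟩, rfl⟩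
  haveI : IsDomain Γ(X, r ⁻¹ᵁ U) := @IsIntegral.component_integral _ _ (r ⁻¹ᵁ U) ⟨⟨_, hmem⟩⟩
  haveI : IsRegularRing Γ(X, r ⁻¹ᵁ U) := hreg.isRegularRing_of_isAffineOpen hU
  -- a generator `g₀` of `G`, and `σ = act g₀`
  haveI : Fact p.Prime := ⟨hp⟩
  haveI : IsCyclic G := isCyclic_of_prime_card hcard
  obtain ⟨g₀, hg₀⟩ := IsCyclic.exists_generator (α := G)
  have hord : orderOf g₀ = p := (orderOf_eq_card_of_forall_mem_zpowers hg₀).trans hcard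
  let σ : Γ(X, r ⁻¹ᵁ U) ≃+* Γ(X, r ⁻¹ᵁ U) := MulSemiringAction.toRingEquiv G Γ(X, r ⁻¹ᵁ U) g₀
  have hσ_apply : ∀ b : Γ(X, r ⁻¹ᵁ U), σ b = ρ.act g₀ U b := fun b => by
    simp only [σ, MulSemiringAction.toRingEquiv_apply_apply]
    rfl
  have hσp : σ ^ p = RingEquiv.refl _ := by
    simp only [σ]
    rw [← map_pow, ← hord, pow_orderOf_eq_one, map_one, RingAut.one_eq_refl]
  -- `Γ(X, r⁻¹U)^G = B^σ`
  have hAeq : ρ.invariantsRing U =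
      (σ : Γ(X, r ⁻¹ᵁ U) →+* Γ(X, r ⁻¹ᵁ U)).eqLocus (RingHom.id Γ(X, r ⁻¹ᵁ U)) := by
    ext b
    rw [ActionOver.mem_invariantsRing_iff, RingHom.mem_eqLocus, RingHom.coe_coe, hσ_apply,
      RingHom.id_apply]
    constructor
    · exact fun h => h g₀
    · intro h g
      have hst : g ∈ MulAction.stabilizer G b :=
        (Subgroup.zpowers_le.mpr (MulAction.mem_stabilizer_iff.mpr h)) (hg₀ g)
      exact MulAction.mem_stabilizer_iff.mp hst
  haveI : IsNoetherianRing
      ((σ : Γ(X, r ⁻¹ᵁ U) →+* Γ(X, r ⁻¹ᵁ U)).eqLocus (RingHom.id Γ(X, r ⁻¹ᵁ U))) :=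
    isNoetherianRing_of_ringEquiv (ρ.invariantsRing U) (RingEquiv.subringCongr hAeq)
  by_cases hσ1 : σ = RingEquiv.refl _
  · -- `g₀`, hence `G`, acts trivially on sections: `Γ(X, r⁻¹U)^G = Γ(X, r⁻¹U)`
    have htop : (σ : Γ(X, r ⁻¹ᵁ U) →+* Γ(X, r ⁻¹ᵁ U)).eqLocus (RingHom.id Γ(X, r ⁻¹ᵁ U)) =
        ⊤ := by
      ext b
      simp only [RingHom.mem_eqLocus, RingHom.coe_coe, hσ1, RingEquiv.refl_apply,
        RingHom.id_apply, Subring.mem_top]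
    haveI : IsRegularRing (ρ.invariantsRing U) :=
      IsRegularRing.of_ringEquiv ((Subring.topEquiv (R := Γ(X, r ⁻¹ᵁ U))).symm.trans
        (RingEquiv.subringCongr (hAeq.trans htop)).symm)
    infer_instance
  · -- the localised divisorial hypothesis at a `σ`-fixed prime, from the stalk hypothesis
    have hdiv' : ∀ (𝔮 : Ideal Γ(X, r ⁻¹ᵁ U)) [𝔮.IsPrime], 𝔮.comap σ = 𝔮 →
        ((Ideal.span (Set.range fun b : Γ(X, r ⁻¹ᵁ U) => σ b - b)).map
          (algebraMap Γ(X, r ⁻¹ᵁ U) (Localization.AtPrime 𝔮))).IsPrincipal := by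
      intro 𝔮 _ h𝔮σ
      have h𝔮' : 𝔮.comap (ρ.act g₀ U) = 𝔮 := by
        refine Eq.trans ?_ h𝔮σ
        ext b
        rw [Ideal.mem_comap, Ideal.mem_comap, hσ_apply]
      obtain ⟨x, hxU, hx𝔮, hfix⟩ := stub_fixedPoint_of_comap_act ρ U hU g₀ 𝔮 h𝔮'
      subst hx𝔮
      have hfun : (fun b : Γ(X, r ⁻¹ᵁ U) => σ b - b) = fun b => ρ.act g₀ U b - b :=
        funext fun b => by rw [hσ_apply]
      rw [hfun]
      exact stub_augIdeal_localization_of_stalk ρ U hU g₀ x hxU hfix (hdiv g₀⁻¹ x hfix)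
    haveI : IsRegularRing
        ((σ : Γ(X, r ⁻¹ᵁ U) →+* Γ(X, r ⁻¹ᵁ U)).eqLocus (RingHom.id Γ(X, r ⁻¹ᵁ U))) :=
      isRegularRing_eqLocus hp σ hσ1 hσp hdiv'
    haveI : IsRegularRing (ρ.invariantsRing U) :=
      IsRegularRing.of_ringEquiv (RingEquiv.subringCongr hAeq.symm)
    infer_instance

/-- **Chart form, Noetherianity supplied by finite type** (E. Noether): as in
`isRegularRing_invariantsRing`, for `r : X → Y` affine and locally of finite type over a locally
Noetherian `Y` and `U ⊆ Y` an affine open — then `Γ(X, r⁻¹U)^G` is of finite type over `Γ(Y, U)`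
(`ActionOver.finiteType_diagramMap_invariants`), hence Noetherian, and
`isRegularRing_invariantsRing` applies. [cite: KiralyLutkebohmert2013, Thm 2]
[cite: SGA1, Exp. V, Cor. 1.5] -/
theorem isRegularRing_invariantsRing_of_locallyOfFiniteType {X Y : Scheme.{0}} {r : X ⟶ Y}
    {G : Type} [Group G] [Finite G] (ρ : ActionOver r G) {p : ℕ} (hp : p.Prime)
    (hcard : Nat.card G = p) [IsIntegral X] (hreg : Scheme.IsRegular X)
    [IsAffineHom r] [LocallyOfFiniteType r] [IsLocallyNoetherian Y] (U : Y.affineOpens)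
    (hdiv : ∀ (g : G) (x : X) (hgx : (ρ.aut g).hom.base x = x),
      (Ideal.span (Set.range fun s : X.presheaf.stalk x =>
        (X.presheaf.stalkSpecializes (specializes_of_eq hgx) ≫ (ρ.aut g).hom.stalkMap x).hom s -
          s)).IsPrincipal) :
    IsRegularRing (ρ.invariantsRing U.1) := by
  haveI : IsLocallyNoetherian X := LocallyOfFiniteType.isLocallyNoetherian r
  haveI : IsNoetherianRing Γ(Y, U.1) := IsLocallyNoetherian.component_noetherian U
  haveI : IsNoetherianRing (ρ.invariantsRing U.1) := by
    have h := ρ.finiteType_diagramMap_invariants U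
    letI algAB : Algebra Γ(Y, U.1) (ρ.invariantsRing U.1) :=
      (ρ.invariants.diagramMap.app (.op U.1)).hom.toAlgebra
    haveI : Algebra.FiniteType Γ(Y, U.1) (ρ.invariantsRing U.1) := h
    exact Algebra.FiniteType.isNoetherianRing Γ(Y, U.1) (ρ.invariantsRing U.1)
  exact isRegularRing_invariantsRing ρ hp hcard hreg U.1 (U.2.preimage r) hdiv

end Summit.ResolutionOfSingularities.ResolutionOfSingularities.Theorems.WildQuotientResolution.CyclicTransfer

end
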